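import Mathlib
import Summits.KontsevichZagierPeriods.KontsevichZagierPeriods.Theorems.SoloInformedShearDivBelow
import Summits.KontsevichZagierPeriods.KontsevichZagierPeriods.Theorems.SoloInformedRatBand
import HarnessLib
import HarnessLib.Audit

/-!
# SoloInformed — NONINT-LOCAL: a denominator arc cannot bound the domain (PRES-RAT(2), Phase IV-4)

Solo programme `solo-KontsevichZagierPeriods-informed`, session s110.  Let `K ⊆ ℝ` be a field,
`N, D ∈ K[x, y]`, and let `y = a(x)` (`a` differentiable on `(u, v)`) be a real branch of the zero
set of `D`: `D(x, a(x)) = 0` for `u < x < v`.  Suppose `N(s₀, a(s₀)) ≠ 0` for some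
`s₀ ∈ (u, v)`.  If an open set `Ω` on which `D ≠ 0` contains the band
`{u < x < v, a(x) < y < a(x) + η}` ABOVE the branch (or the band BELOW it), then `N / D` is not
integrable on `Ω` (`soloInformed_nonint_above`, `soloInformed_nonint_below`).

Proof: near `p = (s₀, a(s₀))` continuity gives `|N| ≥ c > 0` and `|∂D/∂y| ≤ L`; the mean value
theorem along vertical segments (`D(x, a(x)) = 0`) gives `|D(x, y)| ≤ L |y − a(x)|`, hence
`|N/D| · |y − a(x)| ≥ c / L` on a smaller adjacent band, and the SHEAR DIVERGENCE lemma
(`soloInformed_not_integrableOn_of_shear_bound[_below]`) applies.  This is the local half of the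
finiteness statement "Z(D) ∩ closure Ω is finite" for integrable rational integrands (design memo
§0, NONINT); the global half is algebraic elimination.

References: folklore; compare `soloInformed_not_integrableOn_of_curveZero` (interior points,
file SoloInformedAnFibre) — here the pole sits on the boundary of the domain.
-/

noncomputable section

open scoped BigOperators Topology
open MeasureTheory Set Filter Metric

namespace Summit.KontsevichZagierPeriods.KontsevichZagierPeriods.Theorems

variable {K : Type*} [Field K] [Algebra K ℝ]

/-! ### Vertical derivatives of `K`-polynomial functions -/

/-- Real points of the complex evaluation: `Re Q^ℂ(x, s) = Q(x, s)`. -/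
theorem soloInformed_re_evalC_ofReal (Q : MvPolynomial (Fin 2) K) (x s : ℝ) :
    (soloInformedEvalC (soloInformedKToC K) Q (x : ℂ) (s : ℂ)).re =
      (MvPolynomial.aeval ![x, s] Q : ℝ) := by
  have h := soloInformed_ofReal_aevalK (K := K) ![x, s] Q
  have ht : soloInformedToC 2 ![x, s] = ![(x : ℂ), (s : ℂ)] := by
    funext i
    fin_cases i <;> simp [soloInformedToC_apply]
  unfold soloInformedEvalC
  rw [← ht, ← h, Complex.ofReal_re]

/-- **`∂/∂y` of `s ↦ P(x, s)` is `(∂P/∂y)(x, s)`.** -/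
theorem soloInformed_hasDerivAt_aevalK_snd (P : MvPolynomial (Fin 2) K) (x t : ℝ) :
    HasDerivAt (fun s : ℝ => (MvPolynomial.aeval ![x, s] P : ℝ))
      (MvPolynomial.aeval ![x, t] (MvPolynomial.pderiv 1 P) : ℝ) t := by
  have hc := (soloInformed_hasDerivAt_evalC_right (soloInformedKToC K) P (x : ℂ) (t : ℂ)).real_of_complex
  simp only [soloInformed_re_evalC_ofReal] at hc
  exact hc

/-- **Vertical mean value bound, upwards.**  If `P(x, α) = 0` and `|∂P/∂y| ≤ L` on the segment
`{x} × [α, y]`, then `|P(x, y)| ≤ L (y − α)`. -/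
theorem soloInformed_abs_aevalK_le_above {P : MvPolynomial (Fin 2) K} {x α y L : ℝ}
    (h0 : (MvPolynomial.aeval ![x, α] P : ℝ) = 0) (hαy : α ≤ y)
    (hL : ∀ s ∈ Icc α y, |(MvPolynomial.aeval ![x, s] (MvPolynomial.pderiv 1 P) : ℝ)| ≤ L) :
    |(MvPolynomial.aeval ![x, y] P : ℝ)| ≤ L * (y - α) := by
  have h := norm_image_sub_le_of_norm_deriv_le_segment'
    (f := fun s : ℝ => (MvPolynomial.aeval ![x, s] P : ℝ))
    (f' := fun s : ℝ => (MvPolynomial.aeval ![x, s] (MvPolynomial.pderiv 1 P) : ℝ))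
    (a := α) (b := y) (C := L)
    (fun s _ => (soloInformed_hasDerivAt_aevalK_snd P x s).hasDerivWithinAt)
    (fun s hs => by rw [Real.norm_eq_abs]; exact hL s (Ico_subset_Icc_self hs)) y
    (right_mem_Icc.2 hαy)
  simpa only [h0, sub_zero, Real.norm_eq_abs] using h

/-- **Vertical mean value bound, downwards.**  If `P(x, α) = 0` and `|∂P/∂y| ≤ L` on the segment
`{x} × [y, α]`, then `|P(x, y)| ≤ L (α − y)`. -/
theorem soloInformed_abs_aevalK_le_below {P : MvPolynomial (Fin 2) K} {x α y L : ℝ}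
    (h0 : (MvPolynomial.aeval ![x, α] P : ℝ) = 0) (hyα : y ≤ α)
    (hL : ∀ s ∈ Icc y α, |(MvPolynomial.aeval ![x, s] (MvPolynomial.pderiv 1 P) : ℝ)| ≤ L) :
    |(MvPolynomial.aeval ![x, y] P : ℝ)| ≤ L * (α - y) := by
  have h := norm_image_sub_le_of_norm_deriv_le_segment'
    (f := fun s : ℝ => (MvPolynomial.aeval ![x, s] P : ℝ))
    (f' := fun s : ℝ => (MvPolynomial.aeval ![x, s] (MvPolynomial.pderiv 1 P) : ℝ))
    (a := y) (b := α) (C := L)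
    (fun s _ => (soloInformed_hasDerivAt_aevalK_snd P x s).hasDerivWithinAt)
    (fun s hs => by rw [Real.norm_eq_abs]; exact hL s (Ico_subset_Icc_self hs)) α
    (right_mem_Icc.2 hyα)
  rw [h0, zero_sub, norm_neg, Real.norm_eq_abs] at h
  exact h

/-! ### Local constants -/

/-- Near a point where `N ≠ 0`: a lower bound `c` for `|N|` and an upper bound `L` for `|∂D/∂y|`
on a `δ`-box. -/
theorem soloInformed_nonint_consts (N D : MvPolynomial (Fin 2) K) (s₀ t₀ : ℝ)
    (hN : (MvPolynomial.aeval ![s₀, t₀] N : ℝ) ≠ 0) :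
    ∃ c L δ : ℝ, 0 < c ∧ 0 < L ∧ 0 < δ ∧ ∀ z : Fin 2 → ℝ, |z 0 - s₀| < δ → |z 1 - t₀| < δ →
      c ≤ |(MvPolynomial.aeval z N : ℝ)| ∧
        |(MvPolynomial.aeval z (MvPolynomial.pderiv 1 D) : ℝ)| ≤ L := by
  set p : Fin 2 → ℝ := ![s₀, t₀] with hp
  have hcN := (soloInformed_continuous_aevalK (K := K) N).continuousAt (x := p)
  have hcD := (soloInformed_continuous_aevalK (K := K) (MvPolynomial.pderiv 1 D)).continuousAt
    (x := p)
  rw [Metric.continuousAt_iff] at hcN hcD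
  have hNp : 0 < |(MvPolynomial.aeval p N : ℝ)| := abs_pos.2 hN
  obtain ⟨δ₁, hδ₁, h₁⟩ := hcN (|(MvPolynomial.aeval p N : ℝ)| / 2) (half_pos hNp)
  obtain ⟨δ₂, hδ₂, h₂⟩ := hcD 1 one_pos
  refine ⟨|(MvPolynomial.aeval p N : ℝ)| / 2, |(MvPolynomial.aeval p (MvPolynomial.pderiv 1 D) : ℝ)| + 1,
    min δ₁ δ₂, half_pos hNp, by positivity, lt_min hδ₁ hδ₂, fun z hz0 hz1 => ?_⟩
  have hdist : dist z p < min δ₁ δ₂ := by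
    rw [dist_pi_lt_iff (lt_min hδ₁ hδ₂)]
    intro i
    fin_cases i
    · simpa [hp, Real.dist_eq] using hz0
    · simpa [hp, Real.dist_eq] using hz1
  have e₁ := h₁ (lt_of_lt_of_le hdist (min_le_left _ _))
  have e₂ := h₂ (lt_of_lt_of_le hdist (min_le_right _ _))
  rw [Real.dist_eq] at e₁ e₂
  constructor
  · have h := abs_sub_abs_le_abs_sub (MvPolynomial.aeval p N : ℝ) (MvPolynomial.aeval z N)
    rw [abs_sub_comm] at h
    linarith
  · have h := abs_sub_abs_le_abs_sub (MvPolynomial.aeval z (MvPolynomial.pderiv 1 D) : ℝ)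
      (MvPolynomial.aeval p (MvPolynomial.pderiv 1 D))
    linarith

/-! ### NONINT-LOCAL -/

/-- **NONINT-LOCAL, upper side.**  A band above a real branch of `Z(D)` inside `Ω` (with `D ≠ 0`
on `Ω` and `N ≠ 0` somewhere on the branch) forbids integrability of `N/D` on `Ω`. -/
theorem soloInformed_nonint_above {N D : MvPolynomial (Fin 2) K} {a a' : ℝ → ℝ}
    {u v η s₀ : ℝ} {Ω : Set (Fin 2 → ℝ)} {f : (Fin 2 → ℝ) → ℝ}
    (hs₀ : u < s₀ ∧ s₀ < v) (hη : 0 < η)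
    (ha : ∀ s : ℝ, u < s → s < v → HasDerivAt a (a' s) s)
    (hZ : ∀ s : ℝ, u < s → s < v → (MvPolynomial.aeval ![s, a s] D : ℝ) = 0)
    (hN : (MvPolynomial.aeval ![s₀, a s₀] N : ℝ) ≠ 0)
    (hΩ : soloInformedAdjBand a u v η ⊆ Ω)
    (hD : ∀ z ∈ Ω, (MvPolynomial.aeval z D : ℝ) ≠ 0)
    (hf : EqOn f (fun z => (MvPolynomial.aeval z N : ℝ) / MvPolynomial.aeval z D) Ω)
    (hint : IntegrableOn f Ω) : False := by
  obtain ⟨c, L, δ, hc, hL, hδ, hcL⟩ := soloInformed_nonint_consts N D s₀ (a s₀) hN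
  obtain ⟨ρ, hρ, haρ⟩ :=
    Metric.continuousAt_iff.1 (ha s₀ hs₀.1 hs₀.2).continuousAt (δ / 2) (half_pos hδ)
  set ρ' : ℝ := min ρ (min (δ / 2) (min (s₀ - u) (v - s₀))) with hρ'
  have hρ'pos : 0 < ρ' :=
    lt_min hρ (lt_min (half_pos hδ) (lt_min (by linarith) (by linarith)))
  have hρ'ρ : ρ' ≤ ρ := min_le_left _ _
  have hρ'δ : ρ' ≤ δ / 2 := le_trans (min_le_right _ _) (min_le_left _ _)
  have hρ'u : ρ' ≤ s₀ - u :=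
    le_trans (min_le_right _ _) (le_trans (min_le_right _ _) (min_le_left _ _))
  have hρ'v : ρ' ≤ v - s₀ :=
    le_trans (min_le_right _ _) (le_trans (min_le_right _ _) (min_le_right _ _))
  set η' : ℝ := min η (δ / 2) with hη'
  have hη'pos : 0 < η' := lt_min hη (half_pos hδ)
  have hη'η : η' ≤ η := min_le_left _ _
  have hη'δ : η' ≤ δ / 2 := min_le_right _ _
  refine soloInformed_not_integrableOn_of_shear_bound (a := a) (a' := a') (u := s₀ - ρ')
    (v := s₀ + ρ') (η := η') (c := c / L) (f := f) (Ω := Ω) (by linarith) hη'pos (div_pos hc hL)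
    (fun s h1 h2 => ha s (by linarith) (by linarith)) ?_ ?_ hint
  · intro z hz
    exact hΩ ⟨⟨by linarith [hz.1.1], by linarith [hz.1.2]⟩, hz.2.1, by linarith [hz.2.2]⟩
  · intro z hz
    obtain ⟨⟨hz0l, hz0r⟩, hz1l, hz1r⟩ := hz
    have hx : u < z 0 ∧ z 0 < v := ⟨by linarith, by linarith⟩
    have hzB : z ∈ Ω := hΩ ⟨hx, hz1l, by linarith⟩
    have hd0 : |z 0 - s₀| < δ := by
      rw [abs_lt]; constructor <;> linarith
    have hax : |a (z 0) - a s₀| < δ / 2 := by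
      have h := haρ (x := z 0) (by rw [Real.dist_eq, abs_lt]; constructor <;> linarith)
      rwa [Real.dist_eq] at h
    have hseg : ∀ t ∈ Icc (a (z 0)) (z 1), |t - a s₀| < δ := by
      intro t ht
      rw [abs_lt] at hax ⊢
      constructor <;> linarith [ht.1, ht.2]
    have hz_eq : ![z 0, z 1] = z := by
      funext i
      fin_cases i <;> rfl
    have hNz : c ≤ |(MvPolynomial.aeval z N : ℝ)| := by
      have h := (hcL ![z 0, z 1] (by simpa using hd0)
        (by simpa using hseg (z 1) ⟨hz1l.le, le_rfl⟩)).1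
      rwa [hz_eq] at h
    have hDz : |(MvPolynomial.aeval z D : ℝ)| ≤ L * (z 1 - a (z 0)) := by
      have h := soloInformed_abs_aevalK_le_above (hZ (z 0) hx.1 hx.2) hz1l.le
        (fun t ht => (hcL ![z 0, t] (by simpa using hd0) (by simpa using hseg t ht)).2)
      rwa [hz_eq] at h
    have hDne := hD z hzB
    have hNeq : |(MvPolynomial.aeval z N : ℝ)| = |f z| * |(MvPolynomial.aeval z D : ℝ)| := by
      rw [hf hzB, abs_div, div_mul_cancel₀ _ (abs_ne_zero.2 hDne)]
    rw [div_le_iff₀ hL]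
    calc c ≤ |f z| * |(MvPolynomial.aeval z D : ℝ)| := hNeq ▸ hNz
      _ ≤ |f z| * (L * (z 1 - a (z 0))) := mul_le_mul_of_nonneg_left hDz (abs_nonneg _)
      _ = |f z| * (z 1 - a (z 0)) * L := by ring

/-- **NONINT-LOCAL, lower side.**  A band below a real branch of `Z(D)` inside `Ω` (with `D ≠ 0`
on `Ω` and `N ≠ 0` somewhere on the branch) forbids integrability of `N/D` on `Ω`. -/
theorem soloInformed_nonint_below {N D : MvPolynomial (Fin 2) K} {a a' : ℝ → ℝ}
    {u v η s₀ : ℝ} {Ω : Set (Fin 2 → ℝ)} {f : (Fin 2 → ℝ) → ℝ}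
    (hs₀ : u < s₀ ∧ s₀ < v) (hη : 0 < η)
    (ha : ∀ s : ℝ, u < s → s < v → HasDerivAt a (a' s) s)
    (hZ : ∀ s : ℝ, u < s → s < v → (MvPolynomial.aeval ![s, a s] D : ℝ) = 0)
    (hN : (MvPolynomial.aeval ![s₀, a s₀] N : ℝ) ≠ 0)
    (hΩ : soloInformedAdjBandBelow a u v η ⊆ Ω)
    (hD : ∀ z ∈ Ω, (MvPolynomial.aeval z D : ℝ) ≠ 0)
    (hf : EqOn f (fun z => (MvPolynomial.aeval z N : ℝ) / MvPolynomial.aeval z D) Ω)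
    (hint : IntegrableOn f Ω) : False := by
  obtain ⟨c, L, δ, hc, hL, hδ, hcL⟩ := soloInformed_nonint_consts N D s₀ (a s₀) hN
  obtain ⟨ρ, hρ, haρ⟩ :=
    Metric.continuousAt_iff.1 (ha s₀ hs₀.1 hs₀.2).continuousAt (δ / 2) (half_pos hδ)
  set ρ' : ℝ := min ρ (min (δ / 2) (min (s₀ - u) (v - s₀))) with hρ'
  have hρ'pos : 0 < ρ' :=
    lt_min hρ (lt_min (half_pos hδ) (lt_min (by linarith) (by linarith)))
  have hρ'ρ : ρ' ≤ ρ := min_le_left _ _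
  have hρ'δ : ρ' ≤ δ / 2 := le_trans (min_le_right _ _) (min_le_left _ _)
  have hρ'u : ρ' ≤ s₀ - u :=
    le_trans (min_le_right _ _) (le_trans (min_le_right _ _) (min_le_left _ _))
  have hρ'v : ρ' ≤ v - s₀ :=
    le_trans (min_le_right _ _) (le_trans (min_le_right _ _) (min_le_right _ _))
  set η' : ℝ := min η (δ / 2) with hη'
  have hη'pos : 0 < η' := lt_min hη (half_pos hδ)
  have hη'η : η' ≤ η := min_le_left _ _
  have hη'δ : η' ≤ δ / 2 := min_le_right _ _
  refine soloInformed_not_integrableOn_of_shear_bound_below (a := a) (a' := a') (u := s₀ - ρ')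
    (v := s₀ + ρ') (η := η') (c := c / L) (f := f) (Ω := Ω) (by linarith) hη'pos (div_pos hc hL)
    (fun s h1 h2 => ha s (by linarith) (by linarith)) ?_ ?_ hint
  · intro z hz
    exact hΩ ⟨⟨by linarith [hz.1.1], by linarith [hz.1.2]⟩, by linarith [hz.2.1], hz.2.2⟩
  · intro z hz
    obtain ⟨⟨hz0l, hz0r⟩, hz1l, hz1r⟩ := hz
    have hx : u < z 0 ∧ z 0 < v := ⟨by linarith, by linarith⟩
    have hzB : z ∈ Ω := hΩ ⟨hx, by linarith, hz1r⟩
    have hd0 : |z 0 - s₀| < δ := by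
      rw [abs_lt]; constructor <;> linarith
    have hax : |a (z 0) - a s₀| < δ / 2 := by
      have h := haρ (x := z 0) (by rw [Real.dist_eq, abs_lt]; constructor <;> linarith)
      rwa [Real.dist_eq] at h
    have hseg : ∀ t ∈ Icc (z 1) (a (z 0)), |t - a s₀| < δ := by
      intro t ht
      rw [abs_lt] at hax ⊢
      constructor <;> linarith [ht.1, ht.2]
    have hz_eq : ![z 0, z 1] = z := by
      funext i
      fin_cases i <;> rfl
    have hNz : c ≤ |(MvPolynomial.aeval z N : ℝ)| := by
      have h := (hcL ![z 0, z 1] (by simpa using hd0)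
        (by simpa using hseg (z 1) ⟨le_rfl, hz1r.le⟩)).1
      rwa [hz_eq] at h
    have hDz : |(MvPolynomial.aeval z D : ℝ)| ≤ L * (a (z 0) - z 1) := by
      have h := soloInformed_abs_aevalK_le_below (hZ (z 0) hx.1 hx.2) hz1r.le
        (fun t ht => (hcL ![z 0, t] (by simpa using hd0) (by simpa using hseg t ht)).2)
      rwa [hz_eq] at h
    have hDne := hD z hzB
    have hNeq : |(MvPolynomial.aeval z N : ℝ)| = |f z| * |(MvPolynomial.aeval z D : ℝ)| := by
      rw [hf hzB, abs_div, div_mul_cancel₀ _ (abs_ne_zero.2 hDne)]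
    rw [div_le_iff₀ hL]
    calc c ≤ |f z| * |(MvPolynomial.aeval z D : ℝ)| := hNeq ▸ hNz
      _ ≤ |f z| * (L * (a (z 0) - z 1)) := mul_le_mul_of_nonneg_left hDz (abs_nonneg _)
      _ = |f z| * (a (z 0) - z 1) * L := by ring

end Summit.KontsevichZagierPeriods.KontsevichZagierPeriods.Theorems

end
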